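import Mathlib
import Summits.ResolutionOfSingularities.ResolutionOfSingularities.Theses.AbhyankarShadows
import Summits.ResolutionOfSingularities.ResolutionOfSingularities.Theses.IndSmooth
import Summits.ResolutionOfSingularities.ResolutionOfSingularities.Theorems.PatchingPerfect.Negative.WhyItResists
import Summits.ResolutionOfSingularities.ResolutionOfSingularities.Theorems.SandwichedSingularitiesResolution
import Literature.AlgebraicGeometry.Resolution.ProperModelsModification
import Literature.AlgebraicGeometry.Resolution.ProperModelsJoin
import Literature.AlgebraicGeometry.Resolution.ProperModelsPatchingOfResolution
import Literature.AlgebraicGeometry.Resolution.PrincipalizationToResolution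
import Literature.AlgebraicGeometry.Resolution.CanonicalResolutionProofs
import Literature.AlgebraicGeometry.Resolution.CompletedPullbackRegular
import Literature.AlgebraicGeometry.Resolution.RegularLocusDense
import HarnessLib

/-!
# Crux `PatchingPerfect` (stmt-ResolutionOfSingularities-16089): its EXACT residual is resolution
# over sandwiched-singularity opens over the same perfect field — fieldwise, unconditionally

`PatchingPerfect` (rank 4 of routes `AbhyankarShadows` and `IndSmooth`; one term) reads, for every
prime `p` and every PERFECT field `k` of characteristic `p`: relative local uniformization over
`k` (`RelLU_k`) implies weak resolution of every reduced separated `k`-scheme of finite type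
(`Res_k`). The landed `PatchingPerfect.Negative.patchingPerfect_iff_relLU_imp_properTwoModelPatching`
(p154014) says the crux is, fieldwise, `RelLU_k ⇒` two-model patching of proper models over `k`.
This file pushes Zariski's reduction one step further, FIELDWISE over an arbitrary field `k` (no
perfectness, no characteristic is consumed), to the resolution-type statement that two-model
patching consumes — the per-field slice `SAND_k` of the tree conjecture
`SandwichedLocusResolution p` (resolution of a `k`-variety `M` OVER an open `O ⊇ V` on which `M`
is regular off `V`, `V` proper birational over a REGULAR `k`-variety `U`), the atom at which the
all-fields sibling crux `PatchingRel` (stmt-0642) parked (`Theorems.patchingRel_iff_lurel_imp_sandwichedLocus`):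

* `patchingPerfect_sandwichedLocus_of_resolves` — `Res_k ⇒ SAND_k` (resolve `M`; formal);
* `patchingPerfect_properRegLeification_of_sandwichedLocus` — `SAND_k ⇒` RegLe-ification of one
  morphism of proper models over `k` (Piltant 2013, proof of Prop. 5.1, Step 2: apply `SAND_k` to
  `M` with `O := φ⁻¹(Reg Y) ∪ Reg M`, `V := φ⁻¹(Reg Y)`, `U := Reg Y`; the body of the tree's
  `regLeification_of_sandwichedLocusResolution`, which uses its all-fields hypothesis at `k` only);
* `patchingPerfect_properTwoModelPatching_of_properRegLeification` — RegLe-ify twice on the join;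
* `patchingPerfect_resolves_of_sandwichedLocus_of_relLU` — `SAND_k ∧ RelLU_k ⇒ Res_k` (with the
  landed per-field Zariski–Piltant engine);
* `patchingPerfect_iff_relLU_imp_sandwichedLocus` — **NO SLACK, fieldwise**:
  `PatchingPerfect ↔ ∀ p k perfect, (RelLU_k → SAND_k)`; and
  `indSmooth_patchingPerfect_iff_relLU_imp_sandwichedLocus` for the `IndSmooth` copy;
* `patchingPerfect_of_sandwichedLocusResolution` — hence the crux follows from stmt-0642's
  registered atom `∀ p prime, SandwichedLocusResolution p` (slice to perfect `k`, drop LU): the two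
  cruxes have ONE open statement between them, of which this crux needs the perfect-field slice
  under the extra hypothesis `RelLU_k`.

References: O. Piltant, RACSAM 107 (2013) 91–121, Prop. 5.1 (proof, Steps 2, 5) and Cor. 5.7
[Piltant2013]; O. Zariski, Ann. of Math. 45 (1944) 472–542 [Zariski1944].
-/

noncomputable section

-- single-problem summit: the doubled namespace component `ResolutionOfSingularities` is forced
set_option linter.dupNamespace false

open CategoryTheory AlgebraicGeometry TopologicalSpace Topology
open Literature.AlgebraicGeometry.Resolution
open Summit.ResolutionOfSingularities.ResolutionOfSingularities.Theses
open Summit.ResolutionOfSingularities.ResolutionOfSingularities.Theses.AbhyankarShadows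
  (PatchingPerfect)

namespace Summit.ResolutionOfSingularities.ResolutionOfSingularities.Theorems

/-- **`Res_k ⇒ SAND_k`**: a resolution of `M` is a resolution over every open of `M` (its source
is integral: reduced because regular, irreducible because birational over the integral `M`).
[folklore] -/
theorem patchingPerfect_sandwichedLocus_of_resolves (k : Type) [Field k]
    (h : ∀ (X : Scheme.{0}) (f : X ⟶ Spec (.of k)), IsSeparated f → LocallyOfFiniteType f →
      QuasiCompact f → IsReduced X → Scheme.HasResolution X) :
    ∀ (U M : Scheme.{0}) (f : U ⟶ Spec (.of k)) (g : M ⟶ Spec (.of k)) (O V : M.Opens)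
      (η : (V : Scheme.{0}) ⟶ U),
      IsSeparated f → LocallyOfFiniteType f → QuasiCompact f → IsIntegral U →
      Scheme.IsRegular U → IsSeparated g → LocallyOfFiniteType g → QuasiCompact g →
      IsIntegral M → IsProper η → IsBirational η → η ≫ f = V.ι ≫ g → V ≤ O →
      (∀ x : M, x ∈ O → x ∉ V → IsRegularLocalRing (M.presheaf.stalk x)) →
        ∃ (N : Scheme.{0}) (ρ : N ⟶ M), IsIntegral N ∧ IsProper ρ ∧ IsBirational ρ ∧
          ∀ n : N, ρ n ∈ O → IsRegularLocalRing (N.presheaf.stalk n) := by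
  intro U M f g O V η _ _ _ _ _ hsg hlg hqg hM _ _ _ _ _
  haveI := hM
  obtain ⟨N, ρ, hres⟩ := h M g hsg hlg hqg inferInstance
  haveI : IsProper ρ := hres.isProper
  haveI : IsReduced N := hres.isRegular.isReduced
  haveI : IsIntegral N := hres.isBirational.isIntegral
  exact ⟨N, ρ, inferInstance, inferInstance, hres.isBirational, fun n _ => hres.isRegular n⟩

/-- **`SAND_k ⇒` RegLe-ification of one morphism of proper models over `k`** (Piltant 2013, proof
of Prop. 5.1, Step 2): for `φ : M → Y`, apply `SAND_k` to `M` with `O := φ⁻¹(Reg Y) ∪ Reg M`,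
`V := φ⁻¹(Reg Y)`, `U := Reg Y` (regular, open since `Y` is of finite type over a field, contains
the generic point); the resulting proper birational integral `ρ : N → M`, regular over `O`, is a
proper model dominating `M` (`ProperModel.exists_properModel_of_isBirational`), and "regular over
`O`" reads `ρ⁻¹(Reg M) ⊆ Reg N ∧ (φρ)⁻¹(Reg Y) ⊆ Reg N`. The body of the tree's all-fields
`regLeification_of_sandwichedLocusResolution`, at the one field `k`.
[cite: Piltant2013, Prop. 5.1 (proof, Step 2)] -/
theorem patchingPerfect_properRegLeification_of_sandwichedLocus (k : Type) [Field k]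
    (hS : ∀ (U M : Scheme.{0}) (f : U ⟶ Spec (.of k)) (g : M ⟶ Spec (.of k)) (O V : M.Opens)
      (η : (V : Scheme.{0}) ⟶ U),
      IsSeparated f → LocallyOfFiniteType f → QuasiCompact f → IsIntegral U →
      Scheme.IsRegular U → IsSeparated g → LocallyOfFiniteType g → QuasiCompact g →
      IsIntegral M → IsProper η → IsBirational η → η ≫ f = V.ι ≫ g → V ≤ O →
      (∀ x : M, x ∈ O → x ∉ V → IsRegularLocalRing (M.presheaf.stalk x)) →
        ∃ (N : Scheme.{0}) (ρ : N ⟶ M), IsIntegral N ∧ IsProper ρ ∧ IsBirational ρ ∧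
          ∀ n : N, ρ n ∈ O → IsRegularLocalRing (N.presheaf.stalk n)) :
    ∀ (K : Type) [Field K] [Algebra k K] (M Y : ProperModel k K) (φ : M.Hom Y),
      ∃ (M' : ProperModel k K) (ψ : M'.Hom M), ψ.RegLe ∧ (ψ.comp φ).RegLe := by
  intro K _ _ M Y φ
  let UY : Y.X.Opens :=
    ⟨Scheme.regularLocus Y.X, isOpen_regularLocus_of_locallyOfFiniteType_field Y.π⟩
  let RM : M.X.Opens :=
    ⟨Scheme.regularLocus M.X, isOpen_regularLocus_of_locallyOfFiniteType_field M.π⟩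
  let V : M.X.Opens := φ.f ⁻¹ᵁ UY
  let O : M.X.Opens := V ⊔ RM
  have hVO : V ≤ O := le_sup_left
  have hgenY : genericPoint Y.X ∈ UY := by
    show genericPoint Y.X ∈ Scheme.regularLocus Y.X
    apply Scheme.genericPoints_subset_regularLocus
    rw [genericPoints_eq_singleton]
    rfl
  haveI : Nonempty (UY : Scheme.{0}) := ⟨⟨_, hgenY⟩⟩
  haveI : IsIntegral (UY : Scheme.{0}) := isIntegral_of_isOpenImmersion UY.ι
  have hUreg : Scheme.IsRegular (UY : Scheme.{0}) := fun u =>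
    (isRegularLocalRing_stalk_iff_of_isOpenImmersion UY.ι u).mp u.2
  have hcompat : (φ.f ∣_ UY) ≫ (UY.ι ≫ Y.π) = V.ι ≫ M.π := by
    rw [morphismRestrict_ι_assoc, φ.f_π]
  have hout : ∀ x : M.X, x ∈ O → x ∉ V → IsRegularLocalRing (M.X.presheaf.stalk x) := by
    intro x hx hxV
    rcases Opens.mem_sup.mp hx with h | h
    · exact absurd h hxV
    · exact h
  -- `SAND_k`: a proper birational integral `N → M` regular over `O`
  obtain ⟨N, ρ, hN, hρ, hbir, hreg⟩ := hS (UY : Scheme.{0}) M.X (UY.ι ≫ Y.π) M.π O V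
    (φ.f ∣_ UY) inferInstance inferInstance inferInstance inferInstance hUreg inferInstance
    inferInstance inferInstance inferInstance inferInstance (φ.isBirational.morphismRestrict UY)
    hcompat hVO hout
  haveI := hN
  haveI := hρ
  -- `(N, ρ)` is a proper model dominating `M`
  obtain ⟨M', ψ, e, hψ⟩ := M.exists_properModel_of_isBirational ρ hbir
  subst e
  rw [eqToHom_refl, Category.id_comp] at hψ
  refine ⟨M', ψ, fun y hy => hreg y ?_, fun y hy => hreg y ?_⟩
  · rw [hψ] at hy
    exact Opens.mem_sup.mpr (Or.inr hy)
  · rw [ProperModel.Hom.comp_f, Scheme.Hom.comp_apply, hψ] at hy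
    exact hVO (show φ.f (ρ y) ∈ UY from hy)

/-- **RegLe-ification over `k` ⇒ two-model patching of proper models over `k`** (RegLe-ify twice
on the join `M₁ ⋈ M₂`; the tree's `SandwichedGluing.twoModelPatching_of_regLeification`, at one
field). [cite: Piltant2013, Prop. 5.1 (proof, Step 5)] -/
theorem patchingPerfect_properTwoModelPatching_of_properRegLeification (k : Type) [Field k]
    (h : ∀ (K : Type) [Field K] [Algebra k K] (M Y : ProperModel k K) (φ : M.Hom Y),
      ∃ (M' : ProperModel k K) (ψ : M'.Hom M), ψ.RegLe ∧ (ψ.comp φ).RegLe) :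
    ∀ (K : Type) [Field K] [Algebra k K] [Algebra.EssFiniteType k K],
      ∀ M₁ M₂ : ProperModel k K,
        ∃ (N : ProperModel k K) (φ₁ : N.Hom M₁) (φ₂ : N.Hom M₂), φ₁.RegLe ∧ φ₂.RegLe := by
  intro K _ _ _ M₁ M₂
  obtain ⟨M', ψ, hψ, hψ₂⟩ := h K (ProperModel.join M₁ M₂) M₂ (ProperModel.joinSnd M₁ M₂)
  obtain ⟨M'', ψ', hψ', hψ'₁⟩ := h K M' M₁ (ψ.comp (ProperModel.joinFst M₁ M₂))
  exact ⟨M'', ψ'.comp (ψ.comp (ProperModel.joinFst M₁ M₂)),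
    ψ'.comp (ψ.comp (ProperModel.joinSnd M₁ M₂)), hψ'₁, hψ'.comp hψ₂⟩

/-- **`SAND_k ∧ RelLU_k ⇒ Res_k`**: RegLe-ification from `SAND_k`, two-model patching on the join,
and the per-field Zariski–Piltant engine (landed
`PatchingPerfect.Negative.patchingPerfect_resolves_of_properTwoModelPatching_of_relLU`).
[cite: Piltant2013, Prop. 5.1 and Cor. 5.7] -/
theorem patchingPerfect_resolves_of_sandwichedLocus_of_relLU (k : Type) [Field k]
    (hS : ∀ (U M : Scheme.{0}) (f : U ⟶ Spec (.of k)) (g : M ⟶ Spec (.of k)) (O V : M.Opens)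
      (η : (V : Scheme.{0}) ⟶ U),
      IsSeparated f → LocallyOfFiniteType f → QuasiCompact f → IsIntegral U →
      Scheme.IsRegular U → IsSeparated g → LocallyOfFiniteType g → QuasiCompact g →
      IsIntegral M → IsProper η → IsBirational η → η ≫ f = V.ι ≫ g → V ≤ O →
      (∀ x : M, x ∈ O → x ∉ V → IsRegularLocalRing (M.presheaf.stalk x)) →
        ∃ (N : Scheme.{0}) (ρ : N ⟶ M), IsIntegral N ∧ IsProper ρ ∧ IsBirational ρ ∧
          ∀ n : N, ρ n ∈ O → IsRegularLocalRing (N.presheaf.stalk n))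
    (hLU : ∀ (K : Type) [Field K] [Algebra k K], (⊤ : IntermediateField k K).FG →
      ∀ O : ValuationSubring K, (∀ c : k, algebraMap k K c ∈ O) → ∀ R : Subalgebra k K, R.FG →
        R.toSubring ≤ O.toSubring → ∃ (A : Subalgebra k K) (h : A.toSubring ≤ O.toSubring),
          R ≤ A ∧ A.FG ∧ IsFractionRing A K ∧ IsRegularLocalRing (Localization.AtPrime
            (Ideal.comap (Subring.inclusion h) (IsLocalRing.maximalIdeal O)))) :
    ∀ (X : Scheme.{0}) (f : X ⟶ Spec (.of k)), IsSeparated f → LocallyOfFiniteType f →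
      QuasiCompact f → IsReduced X → Scheme.HasResolution X :=
  PatchingPerfect.Negative.patchingPerfect_resolves_of_properTwoModelPatching_of_relLU k
    (patchingPerfect_properTwoModelPatching_of_properRegLeification k
      (patchingPerfect_properRegLeification_of_sandwichedLocus k hS)) hLU

/-- **NO SLACK, fieldwise: the crux is EQUIVALENT to "relative LU over a perfect `k` implies
resolution over sandwiched-singularity opens over `k`"** — Zariski's reduction of
"LU ⇒ resolution" to the resolution of sandwiched singularities loses nothing, one perfect field
at a time (`⇒`: resolve `M`; `⇐`: `patchingPerfect_resolves_of_sandwichedLocus_of_relLU`). The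
right-hand side is the single registered stub of line `birth` (v3). [cite: Piltant2013, Prop. 5.1 and Cor. 5.7] -/
theorem patchingPerfect_iff_relLU_imp_sandwichedLocus :
    PatchingPerfect ↔ ∀ p : ℕ, p.Prime → ∀ (k : Type) [Field k] [CharP k p] [PerfectField k],
      (∀ (K : Type) [Field K] [Algebra k K], (⊤ : IntermediateField k K).FG →
        ∀ O : ValuationSubring K, (∀ c : k, algebraMap k K c ∈ O) → ∀ R : Subalgebra k K, R.FG →
          R.toSubring ≤ O.toSubring → ∃ (A : Subalgebra k K) (h : A.toSubring ≤ O.toSubring),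
            R ≤ A ∧ A.FG ∧ IsFractionRing A K ∧ IsRegularLocalRing (Localization.AtPrime
              (Ideal.comap (Subring.inclusion h) (IsLocalRing.maximalIdeal O)))) →
      ∀ (U M : Scheme.{0}) (f : U ⟶ Spec (.of k)) (g : M ⟶ Spec (.of k)) (O V : M.Opens)
        (η : (V : Scheme.{0}) ⟶ U),
        IsSeparated f → LocallyOfFiniteType f → QuasiCompact f → IsIntegral U →
        Scheme.IsRegular U → IsSeparated g → LocallyOfFiniteType g → QuasiCompact g →
        IsIntegral M → IsProper η → IsBirational η → η ≫ f = V.ι ≫ g → V ≤ O →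
        (∀ x : M, x ∈ O → x ∉ V → IsRegularLocalRing (M.presheaf.stalk x)) →
          ∃ (N : Scheme.{0}) (ρ : N ⟶ M), IsIntegral N ∧ IsProper ρ ∧ IsBirational ρ ∧
            ∀ n : N, ρ n ∈ O → IsRegularLocalRing (N.presheaf.stalk n) :=
  ⟨fun h p hp k _ _ _ hLU => patchingPerfect_sandwichedLocus_of_resolves k (h p hp k hLU),
    fun h p hp k _ _ _ hLU =>
      patchingPerfect_resolves_of_sandwichedLocus_of_relLU k (h p hp k hLU) hLU⟩

/-- The same equivalence for the `IndSmooth` copy of the shared crux (one term). [folklore] -/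
theorem indSmooth_patchingPerfect_iff_relLU_imp_sandwichedLocus :
    IndSmooth.PatchingPerfect ↔
      ∀ p : ℕ, p.Prime → ∀ (k : Type) [Field k] [CharP k p] [PerfectField k],
      (∀ (K : Type) [Field K] [Algebra k K], (⊤ : IntermediateField k K).FG →
        ∀ O : ValuationSubring K, (∀ c : k, algebraMap k K c ∈ O) → ∀ R : Subalgebra k K, R.FG →
          R.toSubring ≤ O.toSubring → ∃ (A : Subalgebra k K) (h : A.toSubring ≤ O.toSubring),
            R ≤ A ∧ A.FG ∧ IsFractionRing A K ∧ IsRegularLocalRing (Localization.AtPrime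
              (Ideal.comap (Subring.inclusion h) (IsLocalRing.maximalIdeal O)))) →
      ∀ (U M : Scheme.{0}) (f : U ⟶ Spec (.of k)) (g : M ⟶ Spec (.of k)) (O V : M.Opens)
        (η : (V : Scheme.{0}) ⟶ U),
        IsSeparated f → LocallyOfFiniteType f → QuasiCompact f → IsIntegral U →
        Scheme.IsRegular U → IsSeparated g → LocallyOfFiniteType g → QuasiCompact g →
        IsIntegral M → IsProper η → IsBirational η → η ≫ f = V.ι ≫ g → V ≤ O →
        (∀ x : M, x ∈ O → x ∉ V → IsRegularLocalRing (M.presheaf.stalk x)) →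
          ∃ (N : Scheme.{0}) (ρ : N ⟶ M), IsIntegral N ∧ IsProper ρ ∧ IsBirational ρ ∧
            ∀ n : N, ρ n ∈ O → IsRegularLocalRing (N.presheaf.stalk n) :=
  patchingPerfect_iff_relLU_imp_sandwichedLocus

/-- **The crux follows from the sibling crux `PatchingRel`'s registered atom
`∀ p prime, SandwichedLocusResolution p`** (stmt-0642; `Theorems/SandwichedSingularitiesResolution.lean`):
slice to perfect `k` and discard the LU hypothesis. [cite: Piltant2013, Prop. 5.1 and Cor. 5.7] -/
theorem patchingPerfect_of_sandwichedLocusResolution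
    (h : ∀ p : ℕ, p.Prime → SandwichedLocusResolution.{0} p) : PatchingPerfect :=
  patchingPerfect_iff_relLU_imp_sandwichedLocus.mpr fun p hp k _ _ _ _ => h p hp k

/-- … and likewise the `IndSmooth` copy. [cite: Piltant2013, Prop. 5.1 and Cor. 5.7] -/
theorem indSmooth_patchingPerfect_of_sandwichedLocusResolution
    (h : ∀ p : ℕ, p.Prime → SandwichedLocusResolution.{0} p) : IndSmooth.PatchingPerfect :=
  patchingPerfect_of_sandwichedLocusResolution h

end Summit.ResolutionOfSingularities.ResolutionOfSingularities.Theorems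

end
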